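import Summits.ResolutionOfSingularities.ResolutionOfSingularities.Theorems.PurelyInseparableDim4InScopeWinCertFastN
import Summits.ResolutionOfSingularities.ResolutionOfSingularities.Theorems.PurelyInseparableDim4WinCertFast
import Summits.ResolutionOfSingularities.ResolutionOfSingularities.Theorems.PurelyInseparableDim4WinCertF
import HarnessLib
import HarnessLib.Audit.Tags

/-!
# Purely inseparable fourfolds — FULL-GAME WIN CERTIFICATES: fast F-keyed checker with NORMALISED children and EXTERNAL leaves (`winCertHBLFN`)
# [OURS · counted 0 · a certificate format for OUR frame v4, not about resolution]

Census cell «res-dim4-pi» (D-0157 DOOR 2), width seat `res-dim4-p-10` (g5).  The PLAIN-game twin of this seat's in-scope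
instrument `InScopeWinCert.iwinCertHBLFN` (`…InScopeWinCertFastN`, p715381).  res-dim4-p-14's full-game checker
`WinCertSound.winCertHB` (`…WinCertFast`) matches children WITH their books `(r, exc)` and compares UNCOMBINED term lists;
on the unit leaves with exponents `3` one books-tracked list of 81–139 rows exceeds the gate's budget (seat memo
`pub/res-dim4/res-dim4-p-10/UNIT-CLASS-TEXT.md` §8).  Three remarks, none new, give a cheap format:

* **the game reads `F` only** (`WinCertF.stateWins_rebook`, `FlatAbsorb.stateWins_congr`) — children are looked up by their
  POLYNOMIAL (`childInF`), so rows are books-free and de-duplicated by `F`;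
* **normalised children** — the child's term list is put in compact normal form (`InScopeWinCert.compactL`,
  `evalT_compactL`) before the zero test and the look-up (`replyHOKFN`);
* **external leaves** — states whose `StateWins` is an EARLIER THEOREM (a cited block, part or class theorem) are appended to
  the look-up list (`wleafRows`, `winCertHBLFN q L`), exactly as p-13's block grammar does in scope (`wcertStates`,
  `wleaves_of_certs`).

Soundness **`stateWins_of_winCertHBLFN`** is proved row by row like `WinCertSound.stateWins_of_rowOK` (Hasse–Taylor test:
`InScopeWinCert.equiHB_of_isEquimultiplePoint`).  Acceptance over `𝔽₂`: p-14's model `exampleCert` (no leaves) and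
`x₀³(1 + x₁)` in ONE row citing the leaf `x₀x₁` (`WinCertF.stateWins_x0x1`).

Riders: `K`-rational replies over the finite `K` of the certificate (NOT ∀K; nothing ascends from `𝔽₂` to `𝔽₄`); the plain
coordinate game of OUR frame v4, not MODE 1h and not CJS's algorithm; nothing here proves F4-C(2,2), `Terminates1h 2 2` or
resolution of singularities in dimension ≥ 4 / characteristic `p`; counted 0; AI kernel work, weaker than expert review.
bears_on: LADDER-RESOLUTION:D157-DOOR2 (res-dim4-pi · brick (δ) plain column · certificate format).
Supports stmt-ResolutionOfSingularities-16155 (helper).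
-/

set_option linter.dupNamespace false

noncomputable section

namespace Summit.ResolutionOfSingularities.ResolutionOfSingularities.Theorems.PIDim4

namespace WinCertSound

open Literature.AlgebraicGeometry.Resolution
open StepKit InScopeWinCert

variable {K : Type} [Field K] [DecidableEq K]

/-! ## 1. F-keyed look-up, normalised replies, leaf rows -/

/-- **F-keyed child look-up**: the child's POLYNOMIAL occurs among the states of `rest` (books ignored). [folklore] -/
def childInF (rest : WCert K) (c : SData 4 K) : Bool :=
  rest.any fun r => StepKit.equivB c.L r.1.L

/-- Soundness of `childInF`: a cited row has the same polynomial. [folklore] -/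
theorem exists_of_childInF {rest : WCert K} {c : SData 4 K} (h : childInF rest c = true) :
    ∃ r ∈ rest, c.toState.F = r.1.toState.F := by
  unfold childInF at h
  obtain ⟨r, hr, hrc⟩ := List.any_eq_true.mp h
  exact ⟨r, hr, by rw [SData.toState_F, SData.toState_F]; exact (evalT_eq_iff_equivB _ _).mpr hrc⟩

/-- B's reply `(j, b)` is harmless (fast, F-keyed, normalised): rejected by the Hasse–Taylor test, or kills `F`, or its
polynomial — in compact normal form — is certified later. [folklore] -/
def replyHOKFN (q : ℕ) (rest : WCert K) (s : SData 4 K) (S : Finset (Fin 4)) (j : Fin 4) (b : Fin 4 → K) : Bool :=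
  !(equiHB q S j b s) ||
    (StepKit.equivB (compactL (stepD q S j b s).L) [] ||
      childInF rest ⟨compactL (stepD q S j b s).L, (stepD q S j b s).r, (stepD q S j b s).exc⟩)

/-- Leaf states dressed as certificate rows (the centre slot is unused). [folklore] -/
def wleafRows (L : List (SData 4 K)) : WCert K := L.map fun s => (s, ∅)

omit [Field K] [DecidableEq K] in
/-- Membership in `wleafRows`. [folklore] -/
theorem mem_wleafRows {L : List (SData 4 K)} {r : WRow K} (h : r ∈ wleafRows L) : ∃ s ∈ L, r = (s, ∅) := by
  obtain ⟨s, hs, rfl⟩ := List.mem_map.mp h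
  exact ⟨s, hs, rfl⟩

/-- The row states of a batch of certificates (the leaf list a later block cites). [folklore] -/
def wcertStates (Ts : List (WCert K)) : List (SData 4 K) := (Ts.flatMap id).map fun r => r.1

/-- All row states of a won batch are won leaves. [folklore] -/
theorem wleaves_of_certs {q : ℕ} {Ts : List (WCert K)}
    (h : ∀ T ∈ Ts, ∀ row ∈ T, StateWins q row.1.toState) :
    ∀ s ∈ wcertStates Ts, StateWins q s.toState := by
  intro s hs
  obtain ⟨r, hr, rfl⟩ := List.mem_map.mp hs
  obtain ⟨T, hT, hrT⟩ := List.mem_flatMap.mp hr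
  exact h T hT r hrT

/-- Concatenating leaf lists. [folklore] -/
theorem wleaves_append {q : ℕ} {L₁ L₂ : List (SData 4 K)}
    (h₁ : ∀ s ∈ L₁, StateWins q s.toState) (h₂ : ∀ s ∈ L₂, StateWins q s.toState) :
    ∀ s ∈ L₁ ++ L₂, StateWins q s.toState := by
  intro s hs
  rcases List.mem_append.mp hs with h | h
  · exact h₁ s h
  · exact h₂ s h

/-- A polynomial won for every booking gives a won leaf state (any books). [folklore] -/
theorem stateWins_toState_of_forall_books {q : ℕ} {s : SData 4 K}
    (h : ∀ (r : Fin 4 →₀ ℕ) (exc : Finset (Fin 4)), StateWins q (⟨evalT s.L, r, exc⟩ : State K)) :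
    StateWins q s.toState :=
  h _ _

variable [Fintype K]

/-! ## 2. The checker -/

/-- The row check (fast, F-keyed, normalised): TERMINAL (origin not `q`-fold), or a permissible centre all of whose
`K`-rational replies are harmless. [folklore] -/
def rowHOKFN (q : ℕ) (rest : WCert K) (row : WRow K) : Bool :=
  !(permB q Finset.univ row.1.L) ||
    (permB q row.2 row.1.L &&
      decide (∀ j ∈ row.2, ∀ b : Fin 4 → K, b j = 0 → replyHOKFN q rest row.1 row.2 j b = true))

/-- **The fast F-keyed full-game checker with normalised children and external leaves** (children LATER in the list or
among the leaf states `L`). [folklore] -/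
def winCertHBLFN (q : ℕ) (L : List (SData 4 K)) : WCert K → Bool
  | [] => true
  | row :: rest => rowHOKFN q (rest ++ wleafRows L) row && winCertHBLFN q L rest

/-! ## 3. Soundness -/

/-- **SOUNDNESS of one row**: if every state of `rest` is escapable and `rowHOKFN q rest row`, the row's state is
escapable. [folklore] -/
theorem stateWins_of_rowHOKFN {q : ℕ} {rest : WCert K} (hrest : ∀ r ∈ rest, StateWins q r.1.toState)
    {row : WRow K} (h : rowHOKFN q rest row = true) : StateWins q row.1.toState := by
  unfold rowHOKFN at h
  rw [Bool.or_eq_true] at h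
  rcases h with hterm | hmove
  · have hperm : permB q Finset.univ row.1.L = false := by
      rw [Bool.not_eq_true'] at hterm; exact hterm
    exact Game.Wins.terminal (no_permissible_of_not_permB hperm)
  · rw [Bool.and_eq_true, decide_eq_true_eq] at hmove
    obtain ⟨hS, hall⟩ := hmove
    refine Game.Wins.move (m := row.2) ((isPermissibleCentre_iff q row.2 row.1.L).mpr hS) ?_
    rintro s' ⟨j, b, hj, hbj, heq, hne, rfl⟩
    have h := hall j hj b hbj
    unfold replyHOKFN at h
    rw [Bool.or_eq_true, Bool.or_eq_true] at h
    have hF : (CentreBlowup.step q row.2 j b row.1.toState).F = evalT (compactL (stepD q row.2 j b row.1).L) := by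
      rw [step_toState, SData.toState_F, evalT_compactL]
    rcases h with h1 | h2 | h3
    · rw [Bool.not_eq_true'] at h1
      exact absurd (equiHB_of_isEquimultiplePoint heq) (by rw [h1]; exact Bool.false_ne_true)
    · exact absurd (by rw [hF, (evalT_eq_iff_equivB _ _).mpr h2, evalT_nil]) hne
    · obtain ⟨r, hr, hrc⟩ := exists_of_childInF h3
      refine FlatAbsorb.stateWins_congr (hrest r hr) _ ?_
      rw [hF, ← hrc, SData.toState_F]

/-- **SOUNDNESS OF THE FAST F-KEYED FULL-GAME CHECKER WITH NORMALISED CHILDREN AND EXTERNAL LEAVES**: if every leaf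
state is escapable, every row state of a checked certificate is ESCAPABLE (`StateWins`: player A beats every `K`-rational
sequence of replies of B). [folklore] -/
theorem stateWins_of_winCertHBLFN {q : ℕ} {L : List (SData 4 K)} (hL : ∀ s ∈ L, StateWins q s.toState) :
    ∀ {T : WCert K}, winCertHBLFN q L T = true → ∀ row ∈ T, StateWins q row.1.toState
  | [], _ => fun row hrow => absurd hrow List.not_mem_nil
  | row :: rest, h => by
    unfold winCertHBLFN at h
    rw [Bool.and_eq_true] at h
    have hrest := stateWins_of_winCertHBLFN hL h.2
    have hrestL : ∀ r ∈ rest ++ wleafRows L, StateWins q r.1.toState := by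
      intro r hr
      rcases List.mem_append.mp hr with h1 | h2
      · exact hrest r h1
      · obtain ⟨s, hs, rfl⟩ := mem_wleafRows h2
        exact hL s hs
    intro r hr
    rcases List.mem_cons.mp hr with rfl | hr'
    · exact stateWins_of_rowHOKFN hrestL h.1
    · exact hrest r hr'

/-- The ROOT of a checked certificate is escapable. [folklore] -/
theorem stateWins_head_of_winCertHBLFN {q : ℕ} {L : List (SData 4 K)} (hL : ∀ s ∈ L, StateWins q s.toState)
    {row : WRow K} {rest : WCert K} (h : winCertHBLFN q L (row :: rest) = true) : StateWins q row.1.toState :=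
  stateWins_of_winCertHBLFN hL h row List.mem_cons_self

/-- No leaves. [folklore] -/
theorem stateWins_of_winCertHBLFN_nil {q : ℕ} {T : WCert K}
    (h : winCertHBLFN q ([] : List (SData 4 K)) T = true) : ∀ row ∈ T, StateWins q row.1.toState :=
  stateWins_of_winCertHBLFN (fun _ hs => absurd hs List.not_mem_nil) h

/-- Every booking of every row polynomial of a checked certificate is escapable. [folklore] -/
theorem stateWins_books_of_winCertHBLFN {q : ℕ} {L : List (SData 4 K)} (hL : ∀ s ∈ L, StateWins q s.toState)
    {T : WCert K} (h : winCertHBLFN q L T = true) :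
    ∀ row ∈ T, ∀ (r : Fin 4 →₀ ℕ) (exc : Finset (Fin 4)), StateWins q (⟨evalT row.1.L, r, exc⟩ : State K) :=
  fun row hrow r exc => WinCertF.stateWins_rebook (stateWins_of_winCertHBLFN hL h row hrow) r exc

/-! ## 4. Models over `𝔽₂` -/

/-- p-14's PR-12t model `exampleCert` (`x₁³`, centre `{x₁}`) passes with no leaves. [OURS · ‖ K] [folklore] -/
theorem winCertHBLFN_example : winCertHBLFN 2 ([] : List (SData 4 (ZMod 2))) exampleCert = true := by
  decide +kernel

/-- The leaf `x₀x₁` (won for every booking, `WinCertF.stateWins_x0x1`) as a presented state. [folklore] -/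
def leafX0X1 : SData 4 (ZMod 2) := ⟨[(![1, 1, 0, 0], 1)], ![0, 0, 0, 0], ∅⟩

/-- The leaf is won. [folklore] -/
theorem stateWins_leafX0X1 : ∀ s ∈ [leafX0X1], StateWins 2 s.toState := by
  intro s hs
  rw [List.mem_singleton] at hs
  subst hs
  exact stateWins_toState_of_forall_books WinCertF.stateWins_x0x1

/-- `x₀³(1 + x₁)`, centre `{x₀}`: ONE row; the only equimultiple reply with a non-zero transform (the along-centre point
`b = (0,1,0,0)`) presents the polynomial `x₀x₁`, which is cited as the external leaf (its books differ from the leaf's: the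
look-up is by `F`). [folklore] -/
def x0cubeCert : WCert (ZMod 2) := [(⟨[(![3, 0, 0, 0], 1), (![3, 1, 0, 0], 1)], ![0, 0, 0, 0], ∅⟩, {0})]

/-- The one-row certificate passes against the leaf. [OURS · ‖ K] [folklore] -/
theorem winCertHBLFN_x0cube : winCertHBLFN 2 [leafX0X1] x0cubeCert = true := by
  decide +kernel

/-- Hence `x₀³(1 + x₁)` is escapable over `𝔽₂` (plain game), by one row and one cited leaf. [OURS · ‖ K] [folklore] -/
theorem stateWins_x0cube_leaf :
    StateWins 2 (⟨[(![3, 0, 0, 0], 1), (![3, 1, 0, 0], 1)], ![0, 0, 0, 0], ∅⟩ : SData 4 (ZMod 2)).toState :=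
  stateWins_head_of_winCertHBLFN stateWins_leafX0X1 winCertHBLFN_x0cube

end WinCertSound

end Summit.ResolutionOfSingularities.ResolutionOfSingularities.Theorems.PIDim4

end
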